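import Summits.QuantumFields.YangMills.Theorems.BalabanUVNodesN11OffTopSupportsL1Step
import Summits.QuantumFields.YangMills.Theorems.BalabanUVNodesN11K1SupportsOffOmegaTopReduction
import Summits.QuantumFields.YangMills.Theorems.BalabanUVNodesN11TkIteratedFibreReading

/-!
# DAG node N11 ∕ key K1⁹ — THE LOCATED SENTENCE'S OFF-TOP SUPPORT HYPOTHESIS `hsupp` IS A THEOREM AT EVERY STEP: the induction over 11a's generations at the
# record; the Gaussian-bare §2-form slot is positive a.e. for every history of every length (`N ≥ 2`); L's K1 consequent WITHOUT `hsupp` (count-neutral, LOCATED)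

HEADER — WORK-UNIT METADATA.  Cell `pub-ymgap`, YM-PLAN Track A (HUMAN RULING D-0062), seat `pub-ymgap-dag-n11-d` (g37; N11 [B14], s2), route `BalabanUVNodes`, item K1⁹ =
stmt-QuantumFields-27364 (helper lane, `--kind proof --supports 27364 --as helper`, count-neutral).  [III] = [Balaban1988Convergent], [II] = [Balaban1989LargeFieldII].  CONSUMED BY
NAME, nothing modified: this seat's O1 `…N11RestrictedAveragingReverseAC` (★★★ `pi_absolutelyContinuous_map_avgRestrOfRecord_genData_of_two_le`, REVERSE a.c., `N ≥ 2`), O2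
`…N11K1SupportsOffTopFirstStep` (`gaussBare_laws`, `integral_afibre_gaussBare_empty_pos`, `sect2Operand_zero_le`, `measurable_sect2Operand_zero`), P `…N11OffTopSupportsGenerationStep`
(★★★ `genOp_section_pos_ae`, `genOp_update_of_fst_eq`), Q `…N11OffTopSupportsL1Step` (★★★ `genOp_section_lintegral_le`, `integral_w_gaussBare_empty_update_eq`,
`measurable_w_gaussBare_empty`, `w_gaussBare_empty_update_of_ne`), g11 `…N11TkIteratedFibreReading` (`sV'_subset_sV_succ`), g9 `…N11TkOpMeasurable`
(`measurable_genOp_kernelRT`, `measurable_baseCfg`), K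
`…N11K1SupportsOmegaTopGaussianDial` (`sect2Operand_zero_congr_fluct`, `sect2Operand_zero_update_eq`), L `…N11K1SupportsOffOmegaTopReduction` (✓p735871:
`deltaOfRecord_pos_of_admissible_of_window`, `k1_consequent_of_residualBlind_remainder_of_offTop_gaussSupports`), this seat's `…N11BackgroundCoPMeasurable`
(`measurable_UbgOfRecord₁₃CoP`), def-T's 11a ∕ 11c `Node00.TkOfRecord` ∕ `Node00.Sect2FormOfRecord` (`tkBranchOfRecord_succ`, `TkOfRecord_apply`, `baseCfg`, `genOp_nonneg`,
`tkOp_nonneg`, `genDataOfRecord_laws`, `const_empty_mem_admSSeq`, `sect2Operand_pos`), g6 `Node00.TkFirstStepRegionVanishing` (`measurePreserving_restrict_fieldMeasure`).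

WHY (O2 ∕ P ∕ Q headers).  L's located sentence `k1_consequent_of_residualBlind_remainder_of_offTop_gaussSupports` (✓p735871) reaches K1's consequent from the residual-blind
remainder of record under ONE N11-side hypothesis `hsupp`: at every step `k < K` of an admissible run in a window and every child `s` of length `k+1` off the top, the
Gaussian-bare §2-form slot `I^G_P(s)` is positive a.e. on the retained support.  O2 proved the `k = 0` clause; P and Q typed the generic generation steps (positivity under REVERSE
a.c., `∫⁻`-bound by the disintegration inequality).  THIS FILE RUNS THE INDUCTION AT THE RECORD and discharges `hsupp` for every `k`, every `s`, every admissible `θ`, `N ≥ 2` — then restates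
L's sentence without it.

WHAT THIS FILE PROVES (theorems only; 0 `def`, 0 `sorry`; standard axioms).
§1 ★★★ `genStep_of_record` — ONE GENERATION OF RECORD: for the Gaussian-bare weights along `s`, generation `j` (`j + 1 ≤ m + K`, `δ_j > 0`, `N ≥ 2`), the five invariants «`≥ 0`,
   measurable, blind to the fluctuation variables at scales `≥ j`, positive a.e. along every measurable zero-fluctuation section on `sV_j`, uniform `∫⁻`-bound along them» pass from
   `T` to `genOp j (genDataOfRecord … j) T` at level `j+1` on ANY `S′ ⊇ sV′_j` (O1 reverse a.c. + O2's A-normaliser + P + Q).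
§2 `baseCfg_fst_self` · ★★★ `tkBranch_invariant` — THE INDUCTION: the `∅`-branch `𝐓_i(s, ∅)[e^{A(s;0,E′)} ∘ U]` carries the five invariants at every level `i ≤ m + K`
   (base: the zero-term operand is `> 0`, `≤ e^{−E′}`, blind, measurable for measurable `U`; step: §1 with `S′ := sV_{i+1} ⊇ sV′_i`).
§3 ★★★ `sect2Slot_gaussBare_pos_ae` — AT EVERY STEP: for `N ≥ 2`, EVERY history `s` of EVERY length `k+1` (`k + 1 ≤ m + K`, `δ_i > 0 (i ≤ k)`), every zero-term residual with
   measurable background map: a.e. in `V_{k+1}`, `0 < I^G_P(s)(V_{k+1})` (the `{S_j}`-sum ≥ its `∅`-branch ≥ … > 0 a.e.: §2 at level `k`, §1 with `S′ :=` all bonds and the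
   base-configuration section, transported to the field measure).
§4 ★★★★ `offTop_gaussSupports` — L's binder `hsupp` VERBATIM is a THEOREM for every admissible `θ`, `N ≥ 2` (window `γ := 1∕2`; the clauses `Ω_{k+1}(s) ≠ 𝕋`, `χ ≠ 0`, `ρ > 0`
   are not needed) · ★★★★ `k1_consequent_of_residualBlind_remainder` — L's located sentence WITH `hsupp` DISCHARGED (all other binders verbatim, plus `N ≥ 2`).

HONEST FRAMING.  What is settled here is the a.e. POSITIVITY of the tree's own Gaussian-bare slot — [folklore] measure theory (product Haar, disintegration, reverse
absolute continuity of block averaging) about the published formulas (2.18)–(2.23) [III] over landed definitions; the cites are LOCATORS.  The K1 consequent is still reached BY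
FIAT of the Gaussian-dial unit residual exactly as in L: nothing of Bałaban's (3.36)–(3.41) [II] is asserted or refuted; no K1⁹ witness is constructed from Bałaban's estimates;
N11 NOT discharged; K1⁹ NOT closed by this file; counts unmoved (typed 28∕28 · discharged 8∕27 = 8∕28 incl. NODE O) — the chair's rows, not this seat's.  One finite four-torus
programme at fixed `ε = L^{−K}`; NOT ℝ⁴, NOT OS, NOT a mass gap, NOT Clay.  No `sorry`, `axiom`, `def`, `instance`, `notation`.  Sources (locators): [III] (2.18) p.257,
(2.20)–(2.23) p.258, (3.23)–(3.25) p.270; [II] Thm 1 p.355, (3.36)–(3.41) p.383; [Balaban1985Averaging] (10) p.19.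
-/

noncomputable section

open MeasureTheory Function ProbabilityTheory
open scoped BigOperators Matrix.Norms.L2Operator ENNReal NNReal

namespace Summit.QuantumFields.YangMills.Theorems.BalabanUVNodesN11K1SupportsOffTopAllSteps

open Literature.MathematicalPhysics.QuantumFieldTheory.Balaban1983to89 T4Continuum
open T4AdjointCovariance (insA JCfg)
open Node00 Node00.Tk B14.Eq218Concrete
open B10Eq42TorusConstraint (bondsIn)
open BalabanUVNodesN11K1SupportsOmegaTopGaussianDial (sect2Operand_zero_congr_fluct sect2Operand_zero_update_eq)
open BalabanUVNodesN11RestrictedAveragingReverseAC (pi_absolutelyContinuous_map_avgRestrOfRecord_genData_of_two_le)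
open BalabanUVNodesN11K1SupportsOffTopFirstStep (gaussBare_laws integral_afibre_gaussBare_empty_pos sect2Operand_zero_le measurable_sect2Operand_zero)
open BalabanUVNodesN11OffTopSupportsGenerationStep (genOp_section_pos_ae genOp_update_of_fst_eq tkOp_update_of_fst_eq)
open BalabanUVNodesN11TkOpMeasurable (measurable_genOp_kernelRT measurable_baseCfg)
open BalabanUVNodesN11K1SupportsOffOmegaTopReduction (deltaOfRecord_pos_of_admissible_of_window k1_consequent_of_residualBlind_remainder_of_offTop_gaussSupports)
open BalabanUVNodesN11OffTopSupportsL1Step (genOp_section_lintegral_le w_gaussBare_empty_update_of_ne measurable_w_gaussBare_empty integral_w_gaussBare_empty_update_eq)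
open BalabanUVNodesN11TkIteratedFibreReading (sV'_subset_sV_succ)

variable {F : T4Family} {N : ℕ} [NeZero N]

/-! ## §1  One generation OF RECORD: the step data (reverse a.c., the constant A-normaliser, blind measurable weights) and the five invariants propagated -/

section GenStep

variable (ν : Stage7Numerics) (A₁ : ℝ) (M : ℕ) (p : B12.RunParams) (g : ℕ → ℝ)

/-- ★★★ **THE GENERATION STEP AT THE RECORD.**  For the Gaussian-bare weights along a history `s` and generation `j` in the standing range (`N ≥ 2`, `δ_j > 0`): if `T ≥ 0` is measurable,
blind to the fluctuation variables at scales `≥ j`, and along every measurable zero-fluctuation section of the scale-`j` variables on 11a's V-bond set `sV_j` POSITIVE a.e. with a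
UNIFORM `∫⁻`-bound, then `𝐓^{(j)}T = genOp j (genDataOfRecord … j) T` is `≥ 0`, measurable, blind at scales `≥ j+1`, and along every measurable zero-fluctuation section of the scale-`(j+1)`
variables on any `S′ ⊇ sV′_j` POSITIVE a.e. with a uniform `∫⁻`-bound (O1's reverse a.c., O2's A-normaliser, P's and Q's generic steps). [cite: Balaban1988Convergent, (2.20)–(2.22) p.258, (3.24) p.270 (bookkeeping)] -/
theorem genStep_of_record (hN : 2 ≤ N) {n : ℕ} (s : SeqOfRecord F ν M g p.K n) (j : ℕ) {hdec : DecidableEq (PBond (F.P p.K) j)}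
    {hdec' : DecidableEq (PBond (F.P p.K) (j + 1))} (hj : j + 1 ≤ (F.P p.K).m + (F.P p.K).K) (hδ : 0 < deltaOfRecord ν g j A₁)
    {T : MultiCfg (F.P p.K) (SU N) (FluctV N) → ℝ} (hT0 : ∀ ω, 0 ≤ T ω) (hTm : Measurable T)
    (hTfl : ∀ m, j ≤ m → ∀ ω (c : JCfg (F.P p.K) m (SU N) (FluctV N)), c.1 = (ω m).1 → T (Function.update ω m c) = T ω)
    (hTpos : ∀ c : (↥(Set.toFinite (bondsIn j (s.Ω (j + 1))ᶜ)).toFinset → SU N) → MultiCfg (F.P p.K) (SU N) (FluctV N), Measurable c →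
      (∀ y (b : ↥(Set.toFinite (bondsIn j (s.Ω (j + 1))ᶜ)).toFinset), ((c y) j).1 b = y b) → (∀ y i, ((c y) i).2 = 0) →
      ∀ᵐ y ∂(Measure.pi fun _ : ↥(Set.toFinite (bondsIn j (s.Ω (j + 1))ᶜ)).toFinset => (HaarData.haar : Measure (SU N))), 0 < T (c y))
    {Mb : ℝ≥0∞} (hMb : Mb ≠ ⊤)
    (hTI : ∀ c : (↥(Set.toFinite (bondsIn j (s.Ω (j + 1))ᶜ)).toFinset → SU N) → MultiCfg (F.P p.K) (SU N) (FluctV N), Measurable c →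
      (∀ y (b : ↥(Set.toFinite (bondsIn j (s.Ω (j + 1))ᶜ)).toFinset), ((c y) j).1 b = y b) → (∀ y i, ((c y) i).2 = 0) →
      ∫⁻ y, ENNReal.ofReal (T (c y)) ∂(Measure.pi fun _ : ↥(Set.toFinite (bondsIn j (s.Ω (j + 1))ᶜ)).toFinset => (HaarData.haar : Measure (SU N))) ≤ Mb) :
    let T' := genOp j (genDataOfRecord F N (FluctV N) ν M g p.K
      (⟨fun _ _ _ => 1, fun i Λ' ω => ∑ b ∈ (Set.toFinite (bondsIn i (Λ'ᶜ ∩ s.Ω (i + 1)))).toFinset, ‖(ω i).2 b‖ ^ 2, chiAW F N (FluctV N) ν A₁ p g⟩ : TkWeights F N (FluctV N) p.K)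
      s (fun _ => ∅) j) T
    (∀ ω, 0 ≤ T' ω) ∧ Measurable T' ∧
      (∀ m, j + 1 ≤ m → ∀ ω (c : JCfg (F.P p.K) m (SU N) (FluctV N)), c.1 = (ω m).1 → T' (Function.update ω m c) = T' ω) ∧
      (∀ S' : Finset (PBond (F.P p.K) (j + 1)), ∀ hS' : (Set.toFinite (bondsIn (j + 1) (s.Ω (j + 1))ᶜ)).toFinset ⊆ S',
        ∀ c : (↥S' → SU N) → MultiCfg (F.P p.K) (SU N) (FluctV N), Measurable c →
        (∀ z (b : PBond (F.P p.K) (j + 1)) (hb : b ∈ (Set.toFinite (bondsIn (j + 1) (s.Ω (j + 1))ᶜ)).toFinset), ((c z) (j + 1)).1 b = z ⟨b, hS' hb⟩) → (∀ z i, ((c z) i).2 = 0) →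
        ∀ᵐ z ∂(Measure.pi fun _ : ↥S' => (HaarData.haar : Measure (SU N))), 0 < T' (c z)) ∧
      (∃ Mb' : ℝ≥0∞, Mb' ≠ ⊤ ∧ ∀ S' : Finset (PBond (F.P p.K) (j + 1)), ∀ hS' : (Set.toFinite (bondsIn (j + 1) (s.Ω (j + 1))ᶜ)).toFinset ⊆ S',
        ∀ c : (↥S' → SU N) → MultiCfg (F.P p.K) (SU N) (FluctV N), Measurable c →
        (∀ z (b : PBond (F.P p.K) (j + 1)) (hb : b ∈ (Set.toFinite (bondsIn (j + 1) (s.Ω (j + 1))ᶜ)).toFinset), ((c z) (j + 1)).1 b = z ⟨b, hS' hb⟩) → (∀ z i, ((c z) i).2 = 0) →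
        ∫⁻ z, ENNReal.ofReal (T' (c z)) ∂(Measure.pi fun _ : ↥S' => (HaarData.haar : Measure (SU N))) ≤ Mb') := by
  intro T'
  set W : TkWeights F N (FluctV N) p.K := ⟨fun _ _ _ => 1, fun i Λ' ω => ∑ b ∈ (Set.toFinite (bondsIn i (Λ'ᶜ ∩ s.Ω (i + 1)))).toFinset, ‖(ω i).2 b‖ ^ 2,
    chiAW F N (FluctV N) ν A₁ p g⟩ with hW
  set D := genDataOfRecord F N (FluctV N) ν M g p.K W s (fun _ => ∅) j with hD
  -- the generation data of record IS the generic step's literal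
  have hDlit : D = ⟨D.sV, D.sV', kernelRT (avgRestrOfRecord F N p.K j D.sV D.sV'), fun _ => 1, D.sA, D.w⟩ := rfl
  have hT'eq : T' = genOp j ⟨D.sV, D.sV', kernelRT (avgRestrOfRecord F N p.K j D.sV D.sV'), fun _ => 1, D.sA, D.w⟩ T := by
    show genOp j D T = _; rw [← hDlit]
  -- per-generation facts of record
  have havg := measurable_avgRestrOfRecord (F := F) (N := N) p.K j D.sV D.sV'
  have hrev := pi_absolutelyContinuous_map_avgRestrOfRecord_genData_of_two_le F N hN ν M g p.K W s (fun _ => ∅) j (hdec := hdec) hj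
  have hc₀ := integral_afibre_gaussBare_empty_pos (N := N) ν A₁ p g s.Ω j (s.Λ (j + 1)) hδ (hdec := hdec)
  have hwN : ∀ ω : MultiCfg (F.P p.K) (SU N) (FluctV N), (ω j).2 = 0 →
      ∫ a, D.w (Function.update ω j (insA D.sA a (ω j))) ∂(Measure.pi fun _ : ↥D.sA => (volume : Measure (FluctV N))) = _ :=
    fun ω hω => integral_w_gaussBare_empty_update_eq ν A₁ p g s.Ω j (s.Λ (j + 1)) (hdec := hdec) ω hω
  have hwm : Measurable D.w := measurable_w_gaussBare_empty ν A₁ p g s.Ω j (s.Λ (j + 1)) ((s.Λ (j + 1))ᶜ ∩ s.Ω (j + 1))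
  have hwbl : ∀ m, j < m → ∀ ω (c : JCfg (F.P p.K) m (SU N) (FluctV N)), c.1 = (ω m).1 → D.w (Function.update ω m c) = D.w ω :=
    fun m hm ω c _ => w_gaussBare_empty_update_of_ne ν A₁ p g s.Ω j (s.Λ (j + 1)) ((s.Λ (j + 1))ᶜ ∩ s.Ω (j + 1)) (Nat.ne_of_lt hm).symm ω c
  -- integrability along sections from the uniform bound
  have hTint : ∀ c : (↥D.sV → SU N) → MultiCfg (F.P p.K) (SU N) (FluctV N), Measurable c → (∀ y (b : ↥D.sV), ((c y) j).1 b = y b) → (∀ y i, ((c y) i).2 = 0) →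
      Integrable (fun y => T (c y)) (Measure.pi fun _ : ↥D.sV => (HaarData.haar : Measure (SU N))) := fun c hc hcr hcz =>
    ⟨(hTm.comp hc).aestronglyMeasurable, (hasFiniteIntegral_iff_ofReal (Filter.Eventually.of_forall fun y => hT0 _)).2 (lt_of_le_of_lt (hTI c hc hcr hcz) hMb.lt_top)⟩
  refine ⟨?_, ?_, ?_, ?_, ?_⟩
  · -- nonnegativity
    intro ω
    exact genOp_nonneg j (genDataOfRecord_laws F N (FluctV N) ν M g p.K (gaussBare_laws ν A₁ p g s.Ω) s (fun _ => ∅) j) (fun ω => hT0 ω) ω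
  · -- measurability
    rw [hT'eq]
    exact measurable_genOp_kernelRT j D.sV D.sV' _ D.sA measurable_const hwm hTm
  · -- blindness above scale `j`
    intro m hm ω c hc
    exact genOp_update_of_fst_eq j D (Nat.lt_of_succ_le hm) (fun _ _ _ => rfl) (hwbl m (Nat.lt_of_succ_le hm)) T (hTfl m (Nat.le_of_succ_le hm)) ω c hc
  · -- positivity along sections
    intro S' hS' c hc hcr hcz
    rw [hT'eq]
    exact genOp_section_pos_ae (G := SU N) (V := FluctV N) j D.sV D.sV' havg hrev D.sA D.w hc₀ hwN hT0 hTm (hTfl j le_rfl) hTpos hTint S' hS' c hc hcr hcz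
  · -- the uniform `∫⁻`-bound
    have key := fun (S' : Finset (PBond (F.P p.K) (j + 1))) (hS' : D.sV' ⊆ S') (c : (↥S' → SU N) → MultiCfg (F.P p.K) (SU N) (FluctV N)) (hc : Measurable c)
        (hcr : ∀ z (b : PBond (F.P p.K) (j + 1)) (hb : b ∈ D.sV'), ((c z) (j + 1)).1 b = z ⟨b, hS' hb⟩) (hcz : ∀ z i, ((c z) i).2 = 0) =>
      genOp_section_lintegral_le (G := SU N) (V := FluctV N) j D.sV D.sV' havg D.sA D.w hc₀.le hwN hT0 hTm (hTfl j le_rfl) hTI S' hS' c hc hcr hcz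
    exact ⟨_, ENNReal.mul_ne_top ENNReal.ofReal_ne_top hMb, fun S' hS' c hc hcr hcz => by rw [hT'eq]; exact key S' hS' c hc hcr hcz⟩

end GenStep

/-! ## §2  The induction over the generations: the invariant of the `∅`-branch `𝐓_i(s, ∅)[Φ]` of the zero-term operand -/

section Invariant

variable (ν : Stage7Numerics) (A₁ : ℝ) (M : ℕ) (p : B12.RunParams) (g : ℕ → ℝ)
variable {𝔸 : Type*} [NormedRing 𝔸] [NormedAlgebra ℂ 𝔸] [CompleteSpace 𝔸]

omit [NeZero N] in
/-- The base configuration reads the given scale-`k` gauge field at scale `k`. [cite: Balaban1988Convergent, (2.18) p.257 (bookkeeping)] -/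
theorem baseCfg_fst_self (k : ℕ) (Vk : GaugeField (F.P p.K) k (SU N)) (b : PBond (F.P p.K) k) : ((baseCfg (V := FluctV N) k Vk) k).1 b = Vk b := by
  show (if h : k = k then Vk (h ▸ b) else 1) = Vk b
  rw [dif_pos rfl]

/-- ★★★ **THE INVARIANT OF THE `∅`-BRANCH ALONG THE GENERATIONS.**  For the Gaussian-bare weights along a history `s` of length `n`, the zero-term operand
`Φ(ω) = e^{A(s;0,E′)}(U(ω.1))` and every `i ≤ m + K` with `δ_{i′} > 0 (i′ < i)`, `N ≥ 2`, `U` measurable: the branch `T_i := 𝐓_i(s, ∅)[Φ]` (11a's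
`tkBranchOfRecord … i`) is `≥ 0`, measurable, blind to the fluctuation variables at scales `≥ i`, and along every measurable zero-fluctuation section of the scale-`i` gauge
variables on the V-bond set `sV_i` POSITIVE a.e. with a uniform `∫⁻`-bound (base: `Φ > 0`, `Φ ≤ e^{−E′}`, blind, measurable; step: §1 with `S′ := sV_{i+1} ⊇ sV′_i`).
[cite: Balaban1988Convergent, (2.18) p.257, (2.20)–(2.23) p.258, (3.24) p.270 (bookkeeping)] -/
theorem tkBranch_invariant (hN : 2 ≤ N) (Sg : Sect2.Setting 𝔸 (SU N)) (Rz : Sect2.Residual (F.P p.K) 𝔸) {n : ℕ} (s : SeqOfRecord F ν M g p.K n) (E' : ℝ)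
    {U : BgMap F N p.K} (hU : Measurable U) (i : ℕ) (hK : i ≤ (F.P p.K).m + (F.P p.K).K)
    (hδ : ∀ i', i' < i → 0 < deltaOfRecord ν g i' A₁) :
    let T := tkBranchOfRecord F N (FluctV N) ν M g p.K
      (⟨fun _ _ _ => 1, fun l Λ' ω => ∑ b ∈ (Set.toFinite (bondsIn l (Λ'ᶜ ∩ s.Ω (l + 1)))).toFinset, ‖(ω l).2 b‖ ^ 2, chiAW F N (FluctV N) ν A₁ p g⟩ : TkWeights F N (FluctV N) p.K)
      s (fun _ => ∅) i (fun ω => sect2Operand F N (FluctV N) p.K Sg Rz s (Sect2.TermValues.zero : Sect2.TermValues (F.P p.K) 𝔸 (FluctV N) M) E' U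
        (fun _ => ∅, fun l => (ω l).2) fun l => (ω l).1)
    (∀ ω, 0 ≤ T ω) ∧ Measurable T ∧
      (∀ m, i ≤ m → ∀ ω (c : JCfg (F.P p.K) m (SU N) (FluctV N)), c.1 = (ω m).1 → T (Function.update ω m c) = T ω) ∧
      (∀ c : (↥(Set.toFinite (bondsIn i (s.Ω (i + 1))ᶜ)).toFinset → SU N) → MultiCfg (F.P p.K) (SU N) (FluctV N), Measurable c →
        (∀ y (b : ↥(Set.toFinite (bondsIn i (s.Ω (i + 1))ᶜ)).toFinset), ((c y) i).1 b = y b) → (∀ y l, ((c y) l).2 = 0) →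
        ∀ᵐ y ∂(Measure.pi fun _ : ↥(Set.toFinite (bondsIn i (s.Ω (i + 1))ᶜ)).toFinset => (HaarData.haar : Measure (SU N))), 0 < T (c y)) ∧
      (∃ Mb : ℝ≥0∞, Mb ≠ ⊤ ∧
        ∀ c : (↥(Set.toFinite (bondsIn i (s.Ω (i + 1))ᶜ)).toFinset → SU N) → MultiCfg (F.P p.K) (SU N) (FluctV N), Measurable c →
        (∀ y (b : ↥(Set.toFinite (bondsIn i (s.Ω (i + 1))ᶜ)).toFinset), ((c y) i).1 b = y b) → (∀ y l, ((c y) l).2 = 0) →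
        ∫⁻ y, ENNReal.ofReal (T (c y)) ∂(Measure.pi fun _ : ↥(Set.toFinite (bondsIn i (s.Ω (i + 1))ᶜ)).toFinset => (HaarData.haar : Measure (SU N))) ≤ Mb) := by
  letI hdec : ∀ j, DecidableEq (PBond (F.P p.K) j) := fun j a b => Classical.propDecidable (a = b)
  induction i with
  | zero =>
    intro T
    have hpos : ∀ ω, 0 < T ω := fun ω => sect2Operand_pos p.K Sg Rz s _ E' U _ _
    have hle : ∀ ω, T ω ≤ Real.exp (-E') := fun ω => sect2Operand_zero_le p Sg Rz s E' U _ _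
    have hTm : Measurable T := by
      have e : T = fun ω : MultiCfg (F.P p.K) (SU N) (FluctV N) => sect2Operand F N (FluctV N) p.K Sg Rz s
          (Sect2.TermValues.zero : Sect2.TermValues (F.P p.K) 𝔸 (FluctV N) M) E' U (fun _ => ∅, fun _ => 0) (fun l => (ω l).1) := by
        funext ω
        exact sect2Operand_zero_congr_fluct p.K Sg Rz s E' U (fun _ => ∅) (fun l => (ω l).2) (fun _ => 0) (fun l => (ω l).1)
      rw [e]
      exact (measurable_sect2Operand_zero p Sg Rz s E' hU _).comp (measurable_pi_lambda _ fun l => (measurable_pi_apply l).fst)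
    refine ⟨fun ω => (hpos ω).le, hTm, fun m _ ω c hc => sect2Operand_zero_update_eq p.K Sg Rz s E' U (fun _ => ∅) ω m c hc,
      fun c _ _ _ => Filter.Eventually.of_forall fun y => hpos _, ENNReal.ofReal (Real.exp (-E')), ENNReal.ofReal_ne_top, fun c _ _ _ => ?_⟩
    calc ∫⁻ y, ENNReal.ofReal (T (c y)) ∂(Measure.pi fun _ : ↥(Set.toFinite (bondsIn 0 (s.Ω (0 + 1))ᶜ)).toFinset => (HaarData.haar : Measure (SU N)))
        ≤ ∫⁻ _, ENNReal.ofReal (Real.exp (-E')) ∂(Measure.pi fun _ : ↥(Set.toFinite (bondsIn 0 (s.Ω (0 + 1))ᶜ)).toFinset => (HaarData.haar : Measure (SU N))) :=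
          lintegral_mono fun y => ENNReal.ofReal_le_ofReal (hle _)
      _ = ENNReal.ofReal (Real.exp (-E')) := by rw [lintegral_const, measure_univ, mul_one]
  | succ i ih =>
    intro T
    obtain ⟨h0, hm, hfl, hpos, Mb, hMb, hI⟩ := ih (Nat.le_of_succ_le hK) fun i' hi' => hδ i' (Nat.lt_succ_of_lt hi')
    obtain ⟨h0', hm', hfl', hpos', Mb', hMb', hI'⟩ :=
      genStep_of_record ν A₁ M p g hN s i (hdec := hdec i) (hdec' := hdec (i + 1)) hK (hδ i (Nat.lt_succ_self i)) h0 hm hfl hpos hMb hI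
    have hsub := sV'_subset_sV_succ ν M g p.K s i
    exact ⟨h0', hm', hfl', fun c hc hcr hcz => hpos' _ hsub c hc (fun z b hb => hcr z ⟨b, hsub hb⟩) hcz,
      Mb', hMb', fun c hc hcr hcz => hI' _ hsub c hc (fun z b hb => hcr z ⟨b, hsub hb⟩) hcz⟩

end Invariant

/-! ## §3  AT THE RECORD, EVERY STEP: the Gaussian-bare §2-form slot is positive a.e. for every history of every length -/

section AllSteps

variable (ν : Stage7Numerics) (A₁ : ℝ) (M : ℕ) (p : B12.RunParams) (g : ℕ → ℝ)
variable {𝔸 : Type*} [NormedRing 𝔸] [NormedAlgebra ℂ 𝔸] [CompleteSpace 𝔸]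

/-- ★★★ **THE GAUSSIAN-BARE §2-FORM SLOT IS POSITIVE a.e. AT EVERY STEP.**  For `N ≥ 2`, a history `s` of ANY length `k + 1` in the standing range (`k + 1 ≤ m + K`,
`δ_i > 0` for `i ≤ k`), every zero-term residual with measurable background map `U`: a.e. in the scale-`(k+1)` field, `0 < I^G_P(s)(V) = (𝐓_{k+1}(s) e^{A(s;0,E′)})(V)`
(the sum over the `{S_j}`-index is bounded below by its `∅`-branch, `≥ 0` termwise; the `∅`-branch is §2's invariant at level `k` pushed through the last generation by §1
with `S′ :=` ALL scale-`(k+1)` bonds and the base-configuration section, transported to the field measure by 11a's restriction isomorphism).  The `k = 0` instance is O2's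
`sect2Slot_gaussBare_one_pos_ae_of_measurable_bg`. [cite: Balaban1988Convergent, (2.18) p.257, (2.20)–(2.23) p.258, (3.23)–(3.25) p.270 (bookkeeping)] -/
theorem sect2Slot_gaussBare_pos_ae (hN : 2 ≤ N) (Sg : Sect2.Setting 𝔸 (SU N)) (Rz : Sect2.Residual (F.P p.K) 𝔸) {k : ℕ} (s : SeqOfRecord F ν M g p.K (k + 1))
    (hK : k + 1 ≤ (F.P p.K).m + (F.P p.K).K) (hδ : ∀ i, i ≤ k → 0 < deltaOfRecord ν g i A₁) (E' : ℝ) {U : BgMap F N p.K} (hU : Measurable U) :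
    ∀ᵐ V ∂fieldMeasure (F.P p.K) (k + 1) (SU N),
      0 < sect2Slot F N (FluctV N) p.K Sg Rz
        (⟨fun _ _ _ => 1, fun l Λ' ω => ∑ b ∈ (Set.toFinite (bondsIn l (Λ'ᶜ ∩ s.Ω (l + 1)))).toFinset, ‖(ω l).2 b‖ ^ 2,
          chiAW F N (FluctV N) ν A₁ p g⟩ : TkWeights F N (FluctV N) p.K) s (Sect2.TermValues.zero : Sect2.TermValues (F.P p.K) 𝔸 (FluctV N) M) E' U V := by
  letI hdec : ∀ j, DecidableEq (PBond (F.P p.K) j) := fun j a b => Classical.propDecidable (a = b)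
  set W : TkWeights F N (FluctV N) p.K := ⟨fun _ _ _ => 1, fun l Λ' ω => ∑ b ∈ (Set.toFinite (bondsIn l (Λ'ᶜ ∩ s.Ω (l + 1)))).toFinset, ‖(ω l).2 b‖ ^ 2,
    chiAW F N (FluctV N) ν A₁ p g⟩ with hW
  set Φ : SFluct (F.P p.K) (FluctV N) → B15DeterminingSets.MSField (F.P p.K) (SU N) → ℝ :=
    sect2Operand F N (FluctV N) p.K Sg Rz s (Sect2.TermValues.zero : Sect2.TermValues (F.P p.K) 𝔸 (FluctV N) M) E' U with hΦ
  -- §2's invariant at level `k`, pushed through the last generation by §1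
  obtain ⟨h0, hm, hfl, hpos, Mb, hMb, hI⟩ :=
    tkBranch_invariant ν A₁ M p g hN Sg Rz s E' hU k (Nat.le_of_succ_le hK) fun i' hi' => hδ i' hi'.le
  obtain ⟨-, -, -, hpos', -⟩ :=
    genStep_of_record ν A₁ M p g hN s k (hdec := hdec k) (hdec' := hdec (k + 1)) hK (hδ k le_rfl) h0 hm hfl hpos hMb hI
  -- the base-configuration section over ALL scale-`(k+1)` bonds
  have hc : Measurable fun z : ↥(Finset.univ : Finset (PBond (F.P p.K) (k + 1))) → SU N =>
      baseCfg (P := F.P p.K) (V := FluctV N) (k + 1) (fun b => z ⟨b, Finset.mem_univ b⟩) :=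
    (measurable_baseCfg (k + 1)).comp (measurable_pi_lambda _ fun b => measurable_pi_apply _)
  have hae := hpos' Finset.univ (Finset.subset_univ _) _ hc (fun z b _ => baseCfg_fst_self p (k + 1) _ b) (fun z l => baseCfg_snd _ _ _)
  -- transported to the field measure
  have hr := measurePreserving_restrict_fieldMeasure (P := F.P p.K) (j := k + 1) (G := SU N) (Finset.univ : Finset (PBond (F.P p.K) (k + 1)))
  have hae' : ∀ᵐ z ∂(fieldMeasure (F.P p.K) (k + 1) (SU N)).map (fun (V' : GaugeField (F.P p.K) (k + 1) (SU N)) (b : ↥(Finset.univ : Finset (PBond (F.P p.K) (k + 1)))) => V' b),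
      0 < genOp k (genDataOfRecord F N (FluctV N) ν M g p.K W s (fun _ => ∅) k)
        (tkBranchOfRecord F N (FluctV N) ν M g p.K W s (fun _ => ∅) k fun ω => Φ (fun _ => ∅, fun l => (ω l).2) fun l => (ω l).1)
        (baseCfg (k + 1) fun b => z ⟨b, Finset.mem_univ b⟩) := by
    rw [hr.map_eq]; exact hae
  filter_upwards [ae_of_ae_map hr.measurable.aemeasurable hae'] with V hV
  show 0 < TkOfRecord F N (FluctV N) ν M g p.K W (k + 1) s Φ V
  rw [TkOfRecord_apply]
  have hmem : (fun _ => (∅ : Set (Site (F.P p.K) 0))) ∈ admSOfRecord F ν M g p.K (k + 1) s :=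
    const_empty_mem_admSSeq _ (empty_mem_SClassOfRecord F ν g p.K) s
  have hΦpos : ∀ a W', 0 < Φ a W' := fun a W' => sect2Operand_pos p.K Sg Rz s _ E' U a W'
  refine lt_of_lt_of_le ?_ (Finset.single_le_sum
    (f := fun S => tkBranchOfRecord F N (FluctV N) ν M g p.K W s S (k + 1) (fun ω => Φ (S, fun j => (ω j).2) fun j => (ω j).1) (baseCfg (k + 1) V))
    (fun S _ => tkOp_nonneg _ (fun j _ hF' => genOp_nonneg j (genDataOfRecord_laws F N (FluctV N) ν M g p.K (gaussBare_laws ν A₁ p g s.Ω) s S j) hF')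
      (k + 1) (fun _ => (hΦpos _ _).le) _) hmem)
  exact hV

end AllSteps

/-! ## §4  L's off-top support hypothesis `hsupp` (✓p735871) IS A THEOREM for every admissible `θ` (`N ≥ 2`); the K1 consequent without it -/

section AtRecord

/-- ★★★★ **THE LOCATED SENTENCE'S OFF-TOP SUPPORT HYPOTHESIS `hsupp` IS A THEOREM** — verbatim the binder `hsupp` of L's
`k1_consequent_of_residualBlind_remainder_of_offTop_gaussSupports` (✓p735871), for EVERY admissible `θ` and `N ≥ 2` (window `γ := 1∕2`; `δ_i > 0` along an admissible run
in a window `γ < 1` is L's `deltaOfRecord_pos_of_admissible_of_window`; def-R's background map is measurable by `…N11BackgroundCoPMeasurable`; the clauses `Ω_{k+1}(s) ≠ 𝕋`,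
`χ ≠ 0`, `ρ > 0` are not even needed).  LOCATED, count-neutral; nothing of Bałaban asserted; no K1⁹ witness by itself (the consequent below keeps L's other binders).
[cite: Balaban1988Convergent, (2.18) p.257, (2.20)–(2.23) p.258, (3.23)–(3.25) p.270; Balaban1989LargeFieldII, Thm 1 p.355 (bookkeeping)] -/
theorem offTop_gaussSupports (θ : Stage13HParams F N) (hA : θ.Admissible F N) (hN : 2 ≤ N) (e : B12.RunParams → ℝ) :
    ∃ γ : ℝ, 0 < γ ∧ γ < 1 ∧ ∀ P : B12.RunParams, (settingOfRecord₁₃ F N θ.toStage13Params P).flow.InInterval γ P.K → ∀ k, k < P.K →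
      ∀ s : SeqOfRecord F θ.ν θ.τ9.M (gOfRecord₁₃ F N θ.toStage13Params P) P.K (k + 1), s.Ω (k + 1) ≠ Set.univ →
        ∀ᵐ V ∂fieldMeasure (F.P P.K) (k + 1) (SU N), chiSeqOfRecord F N θ.ν θ.τ9.M (gOfRecord₁₃ F N θ.toStage13Params P) P.K (k + 1) s V ≠ 0 →
          0 < slotsOfRecord F N θ.ν θ.τ9 (EOfRecord₁₃ F N θ.toStage13Params) (wOfRecord₉ F N θ.toStage9Params) θ.ppSel P (gOfRecord₁₃ F N θ.toStage13Params P) (k + 1) s V →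
          0 < sect2Slot F N (FluctV N) P.K (settingOfRecord₁₃ F N θ.toStage13Params P) (θ.Rz P.K)
            (⟨fun _ _ _ => 1, fun j Λ' ω => ∑ b ∈ (Set.toFinite (bondsIn j (Λ'ᶜ ∩ s.Ω (j + 1)))).toFinset, ‖(ω j).2 b‖ ^ 2,
              chiAW F N (FluctV N) θ.ν θ.A₁ P (gOfRecord₁₃ F N θ.toStage13Params P)⟩ : TkWeights F N (FluctV N) P.K)
            s Sect2.TermValues.zero (e P) (UbgOfRecord₁₃CoP F N θ.toStage13Params P (k + 1) s) V := by
  refine ⟨1 / 2, by norm_num, by norm_num, fun P hI k hk s _ => ?_⟩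
  have hK : k + 1 ≤ (F.P P.K).m + (F.P P.K).K := by have := F.hm; simp only [T4Family.P_m, T4Family.P_K]; omega
  filter_upwards [sect2Slot_gaussBare_pos_ae θ.ν θ.A₁ θ.τ9.M P (gOfRecord₁₃ F N θ.toStage13Params P) hN (settingOfRecord₁₃ F N θ.toStage13Params P) (θ.Rz P.K) s hK
    (fun i hi => deltaOfRecord_pos_of_admissible_of_window θ hA (by norm_num) hI (hi.trans hk.le)) (e P)
    (BalabanUVNodesN11BackgroundCoPMeasurable.measurable_UbgOfRecord₁₃CoP F N θ.toStage13Params P (k + 1) s)] with V hV _ _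
  exact hV

/-- ★★★★ **K1's CONSEQUENT FROM THE RESIDUAL-BLIND REMAINDER OF RECORD — L's located sentence WITHOUT its support binder `hsupp`** (discharged by `offTop_gaussSupports`;
every other binder of L's `k1_consequent_of_residualBlind_remainder_of_offTop_gaussSupports` kept verbatim, plus `N ≥ 2`).  LOCATED, count-neutral: the printed Theorem 1 is
reached BY FIAT of the Gaussian-dial unit residual exactly as in L (nothing of Bałaban's (3.36)–(3.41) asserted); K1⁹ NOT closed by this file. [cite: Balaban1989LargeFieldII, Thm 1 p.355,
(3.36)–(3.41) p.383; Balaban1988Convergent, (2.18)–(2.23) pp.257–258 (bookkeeping)] -/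
theorem k1_consequent_of_residualBlind_remainder (θ : Stage13HParams F N) (hN : 2 ≤ N) (hP : θ.Provisos₁₃SepCoPH F N)
    (hS : θ.SlotsNondegenerate₁₃ F N) (hA : θ.Admissible F N) (hE₀ : 0 ≤ θ.s2.lf.E₀) (hB₀ : 0 ≤ θ.s2.lf.B₀) (e : B12.RunParams → ℝ)
    (v : Revision₁₃ F N θ hP) (hcor : B16.Cor3_250 (datumOfRecord₁₃SepCoPHV F N θ hP v).C)
    (hwin : ∃ γ₁ : ℝ, 0 < γ₁ ∧ ∀ γ : ℝ, 0 < γ → γ ≤ γ₁ → ∃ P : B12.RunParams, 1 ≤ P.K ∧ ((datumOfRecord₁₃SepCoPHV F N θ hP v).C P).flow.InInterval γ P.K)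
    (hrows : ∃ (b : ℕ → ℝ) (r γ₀ M : ℝ), 0 < γ₀ ∧
      (∀ (n : ℕ) (gs : ℕ → ℝ), FlowStep.RGEqH n (betaOfRecord₁₃ F N θ.toStage13Params) gs → Step.InInterval γ₀ n gs →
        ∀ k, k ≤ n → |betaOfRecord₁₃ F N θ.toStage13Params k (FlowStep.prefixOf gs k) - b k| ≤ r) ∧
      (∀ (n : ℕ) (gs : ℕ → ℝ), FlowStep.RGEqH n (betaOfRecord₁₃ F N θ.toStage13Params) gs → Step.InInterval γ₀ n gs →
        ∀ k, k ≤ n → -M ≤ ∑ j ∈ Finset.Ico k n, betaOfRecord₁₃ F N θ.toStage13Params j (FlowStep.prefixOf gs j)) ∧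
      ∀ k : ℕ, ContinuousOn (fun x : ℝ => betaOfRecord₁₃ F N θ.toStage13Params k (FlowStep.clampPrefix (betaOfRecord₁₃ F N θ.toStage13Params) γ₀ k x))
        {x : ℝ | 0 < x ∧ x ≤ γ₀ ∧ ∀ j, j ≤ k → 1 / γ₀ ^ 2 ≤ FlowStep.Y (betaOfRecord₁₃ F N θ.toStage13Params) γ₀ j x}) :
    ∃ (θ' : Stage13HParams F N) (h' : θ'.Provisos₁₃SepCoPH F N) (v' : Revision₁₃ F N θ' h'),
      (θ'.ZhUnity ∧ θ'.SlotsNondegenerate₁₃ F N) ∧ θ'.Admissible F N ∧ B16.EndStatementBPrinted (datumOfRecord₁₃SepCoPHV F N θ' h' v').C ∧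
      (∃ γ₁ : ℝ, 0 < γ₁ ∧ ∀ γ : ℝ, 0 < γ → γ ≤ γ₁ → ∃ P : B12.RunParams, 1 ≤ P.K ∧ ((datumOfRecord₁₃SepCoPHV F N θ' h' v').C P).flow.InInterval γ P.K) ∧
      ∃ (b : ℕ → ℝ) (r γ₀ M : ℝ), 0 < γ₀ ∧
        (∀ (n : ℕ) (gs : ℕ → ℝ), FlowStep.RGEqH n (betaOfRecord₁₃ F N θ'.toStage13Params) gs → Step.InInterval γ₀ n gs →
          ∀ k, k ≤ n → |betaOfRecord₁₃ F N θ'.toStage13Params k (FlowStep.prefixOf gs k) - b k| ≤ r) ∧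
        (∀ (n : ℕ) (gs : ℕ → ℝ), FlowStep.RGEqH n (betaOfRecord₁₃ F N θ'.toStage13Params) gs → Step.InInterval γ₀ n gs →
          ∀ k, k ≤ n → -M ≤ ∑ j ∈ Finset.Ico k n, betaOfRecord₁₃ F N θ'.toStage13Params j (FlowStep.prefixOf gs j)) ∧
        ∀ k : ℕ, ContinuousOn (fun x : ℝ => betaOfRecord₁₃ F N θ'.toStage13Params k (FlowStep.clampPrefix (betaOfRecord₁₃ F N θ'.toStage13Params) γ₀ k x))
          {x : ℝ | 0 < x ∧ x ≤ γ₀ ∧ ∀ j, j ≤ k → 1 / γ₀ ^ 2 ≤ FlowStep.Y (betaOfRecord₁₃ F N θ'.toStage13Params) γ₀ j x} :=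
  k1_consequent_of_residualBlind_remainder_of_offTop_gaussSupports θ hP hS hA hE₀ hB₀ e v hcor hwin hrows (offTop_gaussSupports θ hA hN e)

end AtRecord

end Summit.QuantumFields.YangMills.Theorems.BalabanUVNodesN11K1SupportsOffTopAllSteps

end
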